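import Literature.MathematicalPhysics.QuantumManyBody.PeriodicHeatFlowSpectral
import Literature.MathematicalPhysics.QuantumManyBody.PeriodizedPotentialNearestImage
import Summits.AtomisticToContinuum.BoseEinsteinCondensation.Theorems.CorrectorClosure.Negative.InsertionResidueLoadBearing
import HarnessLib

/-!
# Existence of the torus Feynman–Kac ground states at fixed density, conditional form
(line `residue-area-law`, stub 1)

Crux `BECInsertionCorrector.CorrectorClosure` (item stmt-AtomisticToContinuum-12058), line
`residue-area-law`, stub `stub_groundStateExists`, in its CONDITIONAL form
`groundStateExists_of_feynmanKac`: the named fact `PeriodicGroundStateFeynmanKac`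
(`PeriodicHeatFlowSpectral.lean`; Perron–Frobenius–Feynman–Kac package on the torus for BOUNDED
periodised potentials) is taken as the hypothesis `hGS`. The stub proper is the one-liner
`groundStateExists_of_feynmanKac PeriodicGroundStateFeynmanKac_holds v hv hbdd` once the fact is
discharged.

Content (pure bookkeeping around the named fact). For a BOUNDED (`v ≤ C`) repulsive profile of
finite range `R₀` and any density `ρ > 0` (no diluteness is needed; `ρ₀ := 1`), in the box of side
`L = sideLength ρ (N + 1) = ((N+1)/ρ)^{1/3} → ∞`:

* `eventually_lt_sideLength_succ` — `a < sideLength ρ (N + 1)` for all large `N`;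
* `periodizedPotential_le_of_range` — for `2R₀ < L` the lattice sum
  `v^per(x) = ∑_{n ∈ ℤ³} v(|x - Ln|)` is a single image at every point
  (`exists_periodizedPotential_eq_single`), hence `v^per ≤ C`;
* `groundStateExists_of_feynmanKac` — eventually in `N`: `v^per` is bounded on the torus of side
  `L`, and the canonical `N`- and `(N+1)`-body torus Feynman–Kac ground states
  `periodicFKGroundState v N L`, `periodicFKGroundState v (N + 1) L` are witnesses of
  `IsPeriodicGroundStateFK`, continuous and strictly positive
  (`PeriodicGroundStateFeynmanKac.periodicFKGroundState` with `1 ≤ N`, `0 < L`).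
-/

noncomputable section

open MeasureTheory Filter Matrix
open scoped ENNReal NNReal BigOperators

namespace Summit.AtomisticToContinuum.BoseEinsteinCondensation.Theorems.CorrectorClosure.ResidueAreaLaw

open Literature.MathematicalPhysics.QuantumManyBody.BoseGas
open Summit.AtomisticToContinuum.BoseEinsteinCondensation.Theorems.CorrectorClosure.Negative
  (sideLength_succ_pos)

/-- The box side `sideLength ρ (N + 1) = ((N+1)/ρ)^{1/3}` exceeds any fixed `a` for all large `N`
(`ρ > 0`). [folklore] -/
theorem eventually_lt_sideLength_succ {ρ : ℝ} (hρ : 0 < ρ) (a : ℝ) :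
    ∀ᶠ N : ℕ in atTop, a < sideLength ρ (N + 1) := by
  have h : Tendsto (fun N : ℕ => sideLength ρ N) atTop atTop :=
    (tendsto_rpow_atTop (by norm_num : (0 : ℝ) < 1 / 3)).comp
      (tendsto_natCast_atTop_atTop.atTop_div_const hρ)
  exact (h.comp (tendsto_add_atTop_nat 1)).eventually_gt_atTop a

/-- **Nearest-image bound.** For a profile `v ≤ C` of range `R₀` (`v(r) = 0` for `r > R₀`) on a
torus of side `L > 2R₀`, the periodised potential is a single lattice image at every point, hence
`v^per ≤ C`. [folklore] -/
theorem periodizedPotential_le_of_range {v : ℝ → ℝ≥0∞} {R₀ L : ℝ} {C : ℝ≥0}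
    (hv : ∀ r, R₀ < r → v r = 0) (h2R : 2 * R₀ < L) (hL : 0 < L) (hC : ∀ r, v r ≤ C)
    (x : Space) : periodizedPotential v L x ≤ C := by
  obtain ⟨n₀, h⟩ := exists_periodizedPotential_eq_single hv h2R hL x
  rw [h]
  exact hC _

/-- **Stub 1 of line `residue-area-law`, conditional on the named fact
`PeriodicGroundStateFeynmanKac`.** For a BOUNDED repulsive finite-range `v` there is `ρ₀ > 0`
(here `ρ₀ = 1`; any density works) such that for `0 < ρ < ρ₀` and all large `N`, in the box
`L = ((N+1)/ρ)^{1/3}`: the periodised potential is bounded, and the `N`- and `(N+1)`-body torus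
Hamiltonians have Feynman–Kac ground states (`IsPeriodicGroundStateFK` for the canonical
`periodicFKGroundState`), continuous and strictly positive. Proof: `L → ∞`, so eventually
`2R₀ < L` and `v^per ≤ C` by the nearest-image bound; then the named fact through
`PeriodicGroundStateFeynmanKac.periodicFKGroundState` with `1 ≤ N ≤ N + 1`, `0 < L`.
[cite: ChungZhao1995, §3.2 (26), Thm 3.10 and Props 3.11–3.15; ReedSimonIV1978, Thm XIII.44] -/
theorem groundStateExists_of_feynmanKac (hGS : PeriodicGroundStateFeynmanKac) (v : ℝ → ℝ≥0∞)
    (hv : IsRepulsiveFiniteRange v) (hbdd : ∃ C : ℝ≥0, ∀ r, v r ≤ C) :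
    ∃ ρ₀ : ℝ, 0 < ρ₀ ∧ ∀ ρ : ℝ, 0 < ρ → ρ < ρ₀ → ∀ᶠ N : ℕ in atTop,
      (∃ C : ℝ≥0, ∀ x, periodizedPotential v (sideLength ρ (N + 1)) x ≤ C) ∧
      (IsPeriodicGroundStateFK v (sideLength ρ (N + 1)) (periodicFKGroundState v N (sideLength ρ (N + 1))) ∧
        Continuous (periodicFKGroundState v N (sideLength ρ (N + 1))) ∧
        ∀ X, 0 < periodicFKGroundState v N (sideLength ρ (N + 1)) X) ∧
      (IsPeriodicGroundStateFK v (sideLength ρ (N + 1))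
          (periodicFKGroundState v (N + 1) (sideLength ρ (N + 1))) ∧
        Continuous (periodicFKGroundState v (N + 1) (sideLength ρ (N + 1))) ∧
        ∀ X, 0 < periodicFKGroundState v (N + 1) (sideLength ρ (N + 1)) X) := by
  refine ⟨1, one_pos, fun ρ hρ _ => ?_⟩
  obtain ⟨C, hC⟩ := hbdd
  obtain ⟨R₀, hR₀⟩ := hv.2
  filter_upwards [eventually_lt_sideLength_succ hρ (2 * R₀), eventually_ge_atTop 1] with N h2R hN
  have hL : 0 < sideLength ρ (N + 1) := sideLength_succ_pos hρ N
  have hb : ∃ C : ℝ≥0, ∀ x, periodizedPotential v (sideLength ρ (N + 1)) x ≤ C :=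
    ⟨C, periodizedPotential_le_of_range hR₀ h2R hL hC⟩
  exact ⟨hb, hGS.periodicFKGroundState hN hL hv.1 hb,
    hGS.periodicFKGroundState (Nat.succ_le_succ (Nat.zero_le N)) hL hv.1 hb⟩

end Summit.AtomisticToContinuum.BoseEinsteinCondensation.Theorems.CorrectorClosure.ResidueAreaLaw

end
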